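import Mathlib
import HarnessLib
import Summits.ResolutionOfSingularities.ResolutionOfSingularities.Theorems.WildQuotientsWildQuotientResolutionS1KillExitDefs
import Summits.ResolutionOfSingularities.ResolutionOfSingularities.Theorems.WildQuotientsWildQuotientResolutionS1KillExitDefsTame
import Summits.ResolutionOfSingularities.ResolutionOfSingularities.Theorems.WildQuotientsWildQuotientResolutionS1aGameFrameWFFrom
import Summits.ResolutionOfSingularities.ResolutionOfSingularities.Theorems.WildQuotientsWildQuotientResolutionS1aGameWins
import Summits.ResolutionOfSingularities.ResolutionOfSingularities.Theorems.WildQuotientsWildQuotientResolutionS1W1NPrint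
import Summits.ResolutionOfSingularities.ResolutionOfSingularities.Theorems.WildQuotientsWildQuotientResolutionS1aFrameWins
import Summits.ResolutionOfSingularities.ResolutionOfSingularities.Theorems.WildQuotientsWildQuotientResolutionS1aWinsOfAuxReachRule
import Summits.ResolutionOfSingularities.ResolutionOfSingularities.Theorems.WildQuotientsWildQuotientResolutionS1aWithinIn
import Summits.ResolutionOfSingularities.ResolutionOfSingularities.Theorems.WildQuotientsWildQuotientResolutionS1aKillFreeF
import Summits.ResolutionOfSingularities.ResolutionOfSingularities.Theorems.WildQuotientsWildQuotientResolutionS1aKillFreeFX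
import Summits.ResolutionOfSingularities.ResolutionOfSingularities.Theses.WildQuotients

/-!
# Line `s1a-logminvertex` v13 «K-FREE FRAME: ONE RESEARCH STUB WITH A FREE ROOT DECORATION — BOUNDED TREES LOWERING THE CARRIED FORMAL MEASURE» (v12's stub `ReachLowerInF` replaced by the strictly weaker `ReachLowerInFX`, plan-1 R-F14b; v11's K ∧ A cut replaced by the single stub, R-F14/R-F14a) — skeleton of the crux `CyclicQuotientFourfolds`
(stmt-ResolutionOfSingularities-17941)

v13 (lead-1 g12, 2026-08-28T20:4xZ; plan-1 g15 A-KF v1 §1.4 (S2) / R-F14b «approved deferred amendment: at the next skeleton touch replace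
`P (initial) (ofNodeAtlas h₀)` by `∃ 𝔄₀, P (initial) 𝔄₀`»): ONLY the research stub changes — `stub_reachLowerInFX : ∀ p prime, S1.ReachLowerInFX p`
(`…S1aKillFreeFX`); `stub_winningStrategy` is proved from it by `S1.winningStrategy_of_reachLowerInFX`; door, glue and the composition
`CyclicQuotientFourfolds_of` are byte-identical to v12. Everything below this paragraph is v12's header, kept verbatim for the record.

[OURS · L1 W4.5c] — NOT statements of the manuscript; counted 0 post-V5; AI-level planning, weaker than expert
review. Crux (route `WildQuotients`, S1 cut of `WildQuotientResolution` stmt-…-15640):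
`CyclicQuotientFourfolds` = for `k` perfect of characteristic `p`, `G` of order `p` acting on a REGULAR integral
`X′` with Galois-type quotient `q : X′ → X₁ = X′/G`, `dim X₁ ≤ 4` ⇒ `X₁` has a resolution.

THE LINE, v6 (plan-1 gen 11, 2026-08-27; supersedes v5 47061bb625717adf in the SHAPE of the termination stub only —
same mathematics): THE FRAME IS A TREE THEOREM. The four game-frame stubs of v4/v5 are closed by name
(`S1.stub_blowupNodeAtlas` p586157, `S1.stub_initialAtlas` p586632, `S1.stub_frameAssembly` p586291, and the v5 glue
content `S1.ExitAssemblyTame.stub_exitAssemblyTame_holds` p586833), lead-1's `GameFrame.Wins` (p586880: terminal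
models win; a model with an admissible centre all of whose moves win, wins — the weakest strategy statement feeding
the frame, with the exit-once / history bookkeeping inside the game tree) is the TARGET OF RECORD (plan-1 RULING
23:53:56Z), and `S1.FrameWins.globalKillTame_of_winningStrategy` / `cyclicQuotientFourfolds_of_door_of_wins`
(`…S1aFrameWins`) assemble: modulo the published tame-quotient resolution theorem (Bergh–Rydh 2019, named fact; door
rung D0 `S1.DoorLadder.door_of_berghRydh` p586600) THE SUB-CRUX IS EXACTLY THE WINNING-STRATEGY STATEMENT.
The METHOD for the winning strategy is unchanged (STRATEGY-DESIGN v2: the ADAPTED LOG-MIN-VERTEX GAME on `G`-models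
with node atlases; rule (R0) local-ring N̄-depth weighted blow-up with unit straightening + (R1) log-min-vertex LP;
P-relative measure μ̂ v2 = (ν₁, ν₃′, ν₂rev, ν₄) ⇒ `GameFrame.wins_of_strategyWFFrom`; ladder (T0) terminal
recognition `L/w45c/W45cT0Signatures.lean`, (T2) one-shot N̄-rule theorem, (T3)–(T5)). THE DOOR is v5's, verbatim
(scheme level, `p`-free; EXIT-DOOR-DESIGN v1: OURS route = torification of the diagonalizable action on the tame
charts DOWNSTAIRS (Abramovich–Temkin 2017 Thm 1/2/3) ⇒ log regular ⇒ `Kato1994_logRegularScheme_hasResolution_holds` /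
`Niziol2006_logRegularScheme_hasResolution_holds`, tree THEOREMS; ladder D0 ✓ – D5).

v7 (lead-1 g8 RESHAPE, 2026-08-28T09:00Z; plan-1 g12 RESIDUAL OF RECORD v3, STRATEGY-DESIGN v3.6 / SIG KA v3): the termination stub
`stub_winningStrategy` of v6 is NO LONGER A STUB — it is PROVED here from two REGISTERED RESEARCH STUBS by the tree theorem
`S1.winsOfSeqRule : WinsOfSeqRule p` (p617886; `…S1aWinsOfSeqRule`: the sequential two-phase rule with measure `jInf`, lexicographic induction
`GameFrame.GModel.wins_of_killOrAuxSeq` p617363, KILL half `…S1aKillFamily` p614162, AUX half `…S1aAuxTop`/`…S1aSeqRule` p613609/p617363; every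
formal clause of the two-phase diagram — G1, transport both ways, chart shrink, gluing by intersection, extension by the unit filtration, the top
components — is a tree theorem of gen 8, memo `Lines/s1a-logminvertex-FRAME-STATUS-rev7.md`).

v8 (lead-1 g9 RESHAPE, 2026-08-28T09:30Z): the K stub is WEAKENED BY A THEOREM to the TOUCH form. For a principal centre the trace
`badLocus ∩ supp 𝒦_d = badLocus ∩ principalKillOpen` is CLOPEN in the bad locus (`…S1aKillClopen` p620298, from G1), the bad locus of a principal move is
homeomorphic to `badLocus ∖ supp 𝒦_d` (`…S1aKillTouch` p620846: embedding with exact range), so a principal move whose support merely TOUCHES the bad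
locus removes whole connected components of it and lowers the number of irreducible components (`…S1aCompCount` p620488); with the measure
`(jInf, n, nIrrComp badLocus)` the lexicographic induction `GameFrame.GModel.wins_of_killTouchOrAuxSeq` needs, at an all-killable model, only ONE principal
centre whose support meets the bad locus — one connected component of `Z(M)` at a time, each with its own Veronese degree, no disjointness / simultaneity
(`killTouchReach_of_killFamilyReach`: the v7 stub implies the v8 stub). `stub_winningStrategy` is proved by `S1.winsOfTouchRule` (`…S1aWinsOfTouchRule`).

v9 (lead-1 g9 RESHAPE, 2026-08-28T10:00Z): the A stub is WEAKENED BY A THEOREM as well, to `AuxWithinReach p` := at every reachable non-terminal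
model with `jInf ≠ ⊥`, `(∃ n, AuxTopWithin n M) ∨ (∃ n, AuxOrbitWithin n M)` (`…S1aOrbitRule`; `auxWithinReach_of_auxTopWithinReach` = `Or.inl`). The new
disjunct is the ONE-ORBIT form: a bounded aux sequence along which `(jInf, topCount)` (`topCount` = number of top-dimensional irreducible components of
the non-killable locus, `…S1aAuxOrbit` p621949) does not increase lexicographically, ending where an aux centre contains SOME top non-killable component
in its support and makes the bad points over it killable — then `(jInf, topCount)` drops (`lex_lt_of_move_of_auxOrbitAt`: the (A3) inducing map is an
embedding off the support; an embedding of equal-dimensional spaces missing a top component lowers the top count). `stub_winningStrategy` is proved by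
`S1.winsOfOrbitRule` (`…S1aWinsOfOrbitRule`; nested induction `wins_of_touchOrTopOrOrbitSeq`: `jInf` ▸ `topCount` ▸ per branch).

v10 (lead-1 g9 RESHAPE, 2026-08-28T11:00Z): both research stubs are restricted to the models reachable from the initial model by AUX MOVES ONLY
(`GameFrame.GModel.ReachableAux`, `…S1aReachAux`): every centre the strategy blows up is an aux centre (principal ⇒ aux), so the invariant class of the
winning induction may be taken to be `ReachableAux (initial)` (`wins_of_touchOrTopOrOrbitSeq_aux`); arbitrary admissible moves may spoil good points, aux
moves never do. `KillTouchReachAux` / `AuxWithinReachAux` are the v9 statements verbatim with `Reachable` replaced by `ReachableAux` — WEAKER BY A THEOREM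
(`killTouchReachAux_of_killTouchReach`, `auxWithinReachAux_of_auxWithinReach`). `stub_winningStrategy` is proved by `S1.winsOfAuxReachRule`
(`…S1aWinsOfAuxReachRule`). ATTACK FORMS OF RECORD (typed sufficient conditions, plan-1 CHAIN v10.17; not stubs): K ⇐ `KillChartsReach` ⇐ `KillAgreeReach`
(…S1aKillCharts p624220 / …S1aKillGlue p623915; per-chart degrees …S1aVeroneseDegree p624722; local agreement …S1aLocalAgree p624970); A ⇐ `AuxChartsWithinReach`
(…S1aAuxCharts).

v11 (plan-1 g14 RESHAPE, 2026-08-28; memo `Lines/s1a-logminvertex-A-TRAP-v1.md` §7, SIG `Lines/W45cWithinInSig.lean` → `…S1aWithinIn`): the AUX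
stub is weakened from the UNIVERSAL form `AuxWithinReachAux p` (a certificate at EVERY aux-reachable model — presumably FALSE: A-TRAP v1 exhibits
SEMISIMPLE TRAPS, bad curves with `θ̃` of non-nilpotent linear part, reachable from the generic two-plane node by three legal `(a′)₁`-admissible
`jInf`-monotone aux moves, at which no `δ ≥ 1` centre is admissible) to the ∃-CLASS form `AuxWithinIn p`: for every datum there is a class `P` of models
containing the initial model, inside `ReachableAux`, closed under KILL moves, such that every non-terminal `P`-model with `jInf ≠ ⊥` carries a bounded
AUX-TOP or AUX-ORBIT certificate ALL OF WHOSE MOVES STAY IN `P` (`AuxTopWithinIn P` / `AuxOrbitWithinIn P`). WEAKER BY A THEOREM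
(`S1.auxWithinIn_of_auxWithinReachAux`); TRUE iff some two-phase strategy of the registered shape wins; `stub_winningStrategy` is proved by
`S1.winningStrategy_of_killTouchReachAux_of_auxWithinIn` (`wins_of_touchOrTopOrOrbitSeq_in`: the v10 nested induction verbatim with the class closed
under kill moves only). The KILL stub, the door and the composition are v10's verbatim. Intended witness class: the NIL models (pro-nilpotent `θ̃` at
every bad point) reachable by TRIANGULAR aux moves and kills (A-TRAP v1 §6, the A-NIL lemma; A-STRUCT v1/v1.1/v1.2 for the rule).

v12 (lead-1 g11 RESHAPE, plan-1 g14 RULINGS R-F14/R-F14a, 2026-08-28; findings F10/F11/F12, memos `Lines/s1a-logminvertex-FRAME-STATUS-rev13.md`,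
plan-1 `Lines/s1a-logminvertex-NP-FRAME-v1*.md`, CHAIN v10.33): THE K/A CUT IS ABANDONED. Every obstruction found on the K side — typed vs formal badness (F10:
`M.badLocus` is «no tame-root-regular invariant chart», not «augmentation ideal non-principal»; typed tightness needs GOOD⇒PRINCIPAL ⊇ Király–Lütkebohmert's
Conjecture 10), agreement of kill charts with unrelated node data (F11: K-U/K-LEAST/K-EXO live in ONE node ring), presentation-dependence of «principal at u»
(ADD-NP), G1-transport — comes from one design decision: K had to SYNTHESISE a global principal centre from anonymous, persistent, pointwise `KillableAt` witnesses.
Kills never create bad points and are isomorphisms off their support, so postponing a kill buys nothing: the party that FINDS a kill NAMES a global `(𝒦, d)` with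
`IsPrincipalCentre` (verified chart by chart in its own coordinates) and the strategy executes it AT ONCE (F12). The frame of record is therefore K-FREE
(`…S1aKillFree`, `…S1aKillFreeAux`, `…S1aKillFreeF`): DECORATED models `(M, 𝔄)` (atlas DATA `𝔄` = any family of node-data charts `…S1aNpFrame.NodeData`, no
compatibility), the CARRIED FORMAL LOCUS `F_𝔄 = {u | no chart of 𝔄 is principal near u}` ⊇ `Z(M)` (closed, `G`-stable, `= ∅ ⇒ Terminal`; lower bounds on it are
the producer's OWN non-principality — provable — while lower bounds on `Z` would be badness facts), the measure `μ_F = lex(dim F_𝔄, nTopComp F_𝔄, nIrrComp F_𝔄)`,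
and strategy TREES (`TreeF`: refinement nodes, move nodes along admissible centres with a `P`-decoration of every realisation). The ONE research stub is
`stub_reachLowerInF : ∀ p prime, S1.ReachLowerInF p`; `stub_winningStrategy` is proved by `S1.winningStrategy_of_reachLowerInF` (`wins_of_reachLowerInF`: the
triple induction uses only well-foundedness). Tools for the producer (all tree theorems): immediate kills are depth-1 trees (`treeIn_one_of_killNow`,
`lexLT_of_principalMove`), (T1) `lexLT_of_isEmbedding_missing_top`, (T2) `exists_isEmbedding_badLocus_off_support`, (T3) p620846, the bridge
`isGoodAt_of_principalNear`, K-EXO (p651120), K-U/K-LEAST (p645609/p647379), NORMALISE (p651895), the formal K-TIGHT ring half (p652609), the cover/valuative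
producers of gen 9–10. v11's `KillTouchReachAux ∧ AuxWithinIn` and the typed-`Z` twin `ReachLowerIn` (`…S1aKillFree`) remain valid ATTACK FORMS on
`WinningStrategy`; neither is a stub.

STUBS (3; sorries live ONLY here):
* `stub_reachLowerInF` — THE RESEARCH STUB (L/XL): `∀ p prime, S1.ReachLowerInF p` — for every crux datum SOME class `P` of DECORATED models containing
  the initial model with its plain atlas such that from every non-terminal decorated `P`-model a BOUNDED strategy tree inside `P` reaches decorated models of
  lexicographically LOWER `μ_F`. Intended witnesses (census recipe shapes): (KN) a NAMED principal centre meeting `F_𝔄`, executed at once (depth 1); (AK) an aux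
  centre whose support contains a top component of `F_𝔄`, then `≤ k` nested named kills clearing the formal points over its support (D₄: 1 aux + kills; D₅–D₈:
  2 aux + kills); (R) atlas refinements deleting multiplicative points (Laurent charts, plan-1 SIG (M)).
* `stub_tameQuotientResolution` — THE DOOR (L/XL), verbatim v5/v6.
* `stub_exitAssemblyTame` — the v5 glue, verbatim (content landed p586833; closed by name).

COMPOSITION `CyclicQuotientFourfolds_of` is REAL (kernel-checked, no sorry) and UNCHANGED from v6; `stub_winningStrategy` keeps its name and
signature (a theorem since v7; v12: from `stub_reachLowerInF`) so every by-name consumer is unaffected.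
-/

-- single-problem summit: the doubled namespace component `ResolutionOfSingularities` is forced
set_option linter.dupNamespace false

noncomputable section

open CategoryTheory AlgebraicGeometry TopologicalSpace
open Literature.AlgebraicGeometry.Resolution Literature.AlgebraicGeometry.RelativeSpec


namespace Summit.ResolutionOfSingularities.ResolutionOfSingularities.Cruxes.CyclicQuotientFourfolds.S1aLogMinVertex

open Summit.ResolutionOfSingularities.ResolutionOfSingularities.Theorems.WildQuotientResolution
open Summit.ResolutionOfSingularities.ResolutionOfSingularities.Theorems.WildQuotientResolution.S1.NodeAtlas
open Summit.ResolutionOfSingularities.ResolutionOfSingularities.Theorems.WildQuotientResolution.S1.MoveStep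
open Summit.ResolutionOfSingularities.ResolutionOfSingularities.Theorems.WildQuotientResolution.S1.GameFrame

/-- **THE RESEARCH STUB — `ReachLowerInFX p`** (skeleton v13 = plan-1 R-F14b, approved deferred amendment of A-KF v1 §1.4 (S2); typed in `…S1aKillFreeFX`,
lead-1 g12; OURS CANDIDATE, asserted nowhere): for every faithful cyclic datum of order `p` over a perfect field of characteristic `p` with `dim X₁ ≤ 4` there are
a ROOT DECORATION `𝔄₀` of the initial model (ANY node-atlas data `NpFrame.NodeAtlasData`: the plain atlas `ofNodeAtlas h₀`, or the producer's own explicit charts)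
and a class `P ∋ (initial, 𝔄₀)` of DECORATED `G`-models such that from every NON-TERMINAL decorated `P`-model some strategy TREE of bounded depth inside `P`
(`GameFrame.GModel.TreeF`: refinement nodes; move nodes = an ADMISSIBLE centre with, for EVERY realisation `M′`, SOME atlas `𝔄′` with `(M′, 𝔄′) ∈ P`) reaches
decorated models of lexicographically LOWER `μ_F = (dim F_𝔄, nTopComp F_𝔄, nIrrComp F_𝔄)`, `F_𝔄` the CARRIED FORMAL LOCUS. v13 vs v12: STRICTLY WEAKER stub
(`S1.reachLowerInFX_of_reachLowerInF`) — v12 fixed `𝔄₀ := ofNodeAtlas h₀`, whose formal locus is known only up to `badLocus ⊆ F ⊆ Fix(g₀)` ((F-T5) ✓p660451),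
forcing a vacuous refinement node at the root of every master tree; the kernel (`wins_of_reachLowerInF`) is unchanged. INTENDED WITNESSES (X-scheme, A-KF v1
§3): `P` := the finitely many explicit node states of the datum's MASTER TREE; inner nodes = MOVE nodes with the EXPLICIT atlas (`exists_moveAtlas(_of_nodeData)`
✓p661630/p661784: producer norm charts with pinned nodes ∪ old charts restricted off the support; `F′ ⊆ π′⁻¹(F ∖ O) ∪ ⋃ (W_j ∩ R_j)` by residual-ideal
certificates ✓`principalNear_producerChart_of_mem_residual`), last moves = KILLS (`exists_killAtlas`/`exists_atlas_fLocus_eq_empty_of_cover` ✓p656845/p660021),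
leaves `F = ∅` vs issuer `F ≠ ∅` ((F-T0) ✓p658774, (F-T10)); first instance ✓p660379 (J₄, depth 1). WHY IT MIGHT FAIL: unbounded depth for nested tangencies /
singular formal components (cusp, E-types); `G`-stability of aux filtrations off the census; a residual not contained in any single chart (R-F15b (4)).
[OURS · L1 W4.5c] -/
theorem stub_reachLowerInFX : ∀ p : ℕ, p.Prime → S1.ReachLowerInFX p := by
  sorry

/-- **THE TERMINATION CRUX (v6 Wins form) — PROVED (v13) from the ONE research stub** by `S1.winningStrategy_of_reachLowerInFX` (v12 `S1.winningStrategy_of_reachLowerInF`; lead-1 g11 / plan-1 g14 R-F14; v11 `S1.winningStrategy_of_killTouchReachAux_of_auxWithinIn`, v10 `S1.winsOfAuxReachRule`, v9 `S1.winsOfOrbitRule`, v8 `S1.winsOfTouchRule`, v7 `S1.winsOfSeqRule` p617886): for every prime `p`, the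
initial `G`-model of every faithful cyclic datum of order `p` over a perfect field of characteristic `p` with `dim X₁ ≤ 4` WINS the kill game. (The
W1-N normal form hypothesis is no longer used.) [OURS · L1 W4.5c] -/
theorem stub_winningStrategy : ∀ p : ℕ, p.Prime → S1.W1NPrint p → S1.FrameWins.WinningStrategy p :=
  fun p hp _ => S1.winningStrategy_of_reachLowerInFX (stub_reachLowerInFX p hp)

/-- **THE DOOR (v5, scheme level, `p`-free)**: an integral separated quasi-compact scheme of finite type over a
perfect field, of dimension `≤ 4`, which is LOCALLY TAME-ROOT-REGULAR (`S1.LocallyTameRootRegular`: every point has an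
affine open whose ring is the degree-`0` part of a regular Noetherian ring graded by `Π j, ZMod (r j)` with (T1)
homogeneous units of finite-index degrees and (T2) finite generation over degree `0`) HAS A RESOLUTION. True in print:
strictly weaker than Bergh–Rydh 2019 Thm D (tree fact `BerghRydh2019_diagonalizableQuotientResolution`, all
dimensions) via line B's closed passage tame ⇒ BR charts. OURS proof route (EXIT-DOOR-DESIGN v1): (T1)-unit reduction
of torus factors (`S1.TameToBR.InducedTorusStatement`, proved `inducedTorus_holds`), TORIFICATION of the residual
finite diagonalizable action chart by chart (blow-up of the torific ideal `∏_χ B·B_χ`, monomial in homogeneous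
regular parameters; functorial for inert étale maps, so the local blow-ups glue over `Y`), log regularity of the
torified quotient (closed-point computation of (F1-loc) type, tree `LogExitFrames.F1Loc`), then the tree THEOREMS
`Kato1994_logRegularScheme_hasResolution_holds` / `Niziol2006_logRegularScheme_hasResolution_holds` and composition of
proper birational maps. Dimension `≤ 4` is kept so that explicit strata arguments (isolated points: toric; surface
strata: relative minimal resolution of the transversal surface quotient singularity) may also close it. Why it might
fail: only in the OURS formalisation (gluing of the local torific blow-ups = intrinsic-ness of the torific ideal under
change of chart presentation — torific ideals are local on the QUOTIENT but presentation-dependent, e.g. under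
pseudo-reflection charts of a regular open; repair: reduce every presentation at a point to the STABILISER presentation
(Abramovich–Temkin's compatibility of torific ideals with `G`-localisation, Luna's fundamental lemma for diagonalizable
groups) or strip pseudo-reflections first (purity for finite linearly reductive group schemes) — tri-1 2026-08-27T23:29:16Z
(b)); the statement itself is a special case of a published theorem. Signature remarks: `S1.IsTameRootChart` allows
torus factors `r j = 0` — a homogeneous (T1) unit of non-zero degree makes the chart ring Laurent over a finitely graded
one, and line B's proved `S1.TameToBR.InducedTorusStatement` removes them; `μ_p` factors (`p ∣ r j`) are diagonalizable
and allowed. [OURS · L1 W4.5c] -/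
theorem stub_tameQuotientResolution :
    ∀ (k : Type) [Field k] [PerfectField k] (Y : Scheme.{0}) (g : Y ⟶ Spec (.of k))
      [IsIntegral Y] [IsSeparated g] [LocallyOfFiniteType g] [QuasiCompact g],
      S1.LocallyTameRootRegular Y → topologicalKrullDim Y ≤ 4 →
      Literature.AlgebraicGeometry.Resolution.Scheme.HasResolution Y := by
  sorry

/-- **Exit assembly, tame form** (M-sized GLUE): for a datum of the crux at `p`, the door and a KILL-TAME model give
a resolution of `X₁`. Faithful case (`ρ` injective): the model's quotient `Y = V/G` (`ActionOver.glued`) is integral,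
separated, of finite type and quasi-compact over `k` (as derived in line B's closed `S1.stub_tameToBR` /
`…S1aTameBRExitCover`), of dimension `= dim X₁ ≤ 4` (`IsBirational.topologicalKrullDim_eq_of_isProper` for the proper
birational `Y → X₁`, built as in the closed `S1.stub_exitAssembly`), locally tame-root-regular by the model; the door
resolves `Y`, and a resolution of `Y` composed with `Y → X₁` resolves `X₁`. Non-faithful case: `G` of prime order ⇒
`ρ = 1` ⇒ the fibres of `q` are points ⇒ `q` is a finite birational surjection from the regular `X′`, a resolution
(as in `S1.stub_exitAssembly`). [OURS · L1 W4.5c] -/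
theorem stub_exitAssemblyTame :
    ∀ p : ℕ, p.Prime →
      (∀ (k : Type) [Field k] [PerfectField k] (Y : Scheme.{0}) (g : Y ⟶ Spec (.of k))
        [IsIntegral Y] [IsSeparated g] [LocallyOfFiniteType g] [QuasiCompact g],
        S1.LocallyTameRootRegular Y → topologicalKrullDim Y ≤ 4 →
        Literature.AlgebraicGeometry.Resolution.Scheme.HasResolution Y) →
      S1.GlobalKillTame p → S1.CyclicQuotientAt p := by
  sorry

/-- **COMPOSITION (v6)** — real proof, no sorry; invokes the stubs BY NAME and the tree theorems
`S1.FrameWins.globalKillTame_of_winningStrategy`, `S1.stub_W1N_print`; concludes the crux BY NAME. -/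
theorem CyclicQuotientFourfolds_of :
    Summit.ResolutionOfSingularities.ResolutionOfSingularities.Theses.WildQuotients.CyclicQuotientFourfolds :=
  fun p hp =>
    stub_exitAssemblyTame p hp stub_tameQuotientResolution
      (S1.FrameWins.globalKillTame_of_winningStrategy p hp (stub_winningStrategy p hp) (S1.stub_W1N_print p hp))

end Summit.ResolutionOfSingularities.ResolutionOfSingularities.Cruxes.CyclicQuotientFourfolds.S1aLogMinVertex

end
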